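import Summits.CriticalPhenomena.SAWScalingLimit.Theorems.SAWDevelopingMapInteriorFlatteningOneMouthDefs
import Summits.CriticalPhenomena.SAWScalingLimit.Theorems.SAWDevelopingMapInteriorFlatteningOneMouthEstimates

/-!
# `InteriorFlattening` (route SAWDevelopingMap, item stmt-CriticalPhenomena-8297): S3' ⇐ PC, a CONDITIONAL reduction

Line `one-mouth-ball-reduction` for the crux (M) =
`Summit.CriticalPhenomena.SAWScalingLimit.Theses.SAWDevelopingMap.InteriorFlattening`, stub S3'
"windowed far-field coherence" (`stub_farFieldCoherence`, reshape r2):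

  `∃ A > 0, ∀ Λ` simply connected, `∀ a ∈ ∂Λ`, `∀ v ∈ Λ`, `∀ r ≥ 1` with `B(v,2r) ⊆ Λ ⊉ B(v,4r)`, for every
  labelling `(w₀,w₁,w₂)`:  `Σ_c ‖amp_c‖ ‖M_c‖ ≤ A ‖Σ_c amp_c M_c‖`,

the sum running over the last-entrance configurations `c` of the lattice ball `S = B(v,r)` (objects `Conf`,
`ball`, `amp`, `mono`, `root` of the Defs module `…Theorems.SAWDevelopingMapInteriorFlatteningOneMouthDefs`).

THIS FILE IS A CONDITIONAL REDUCTION ONLY. Its hypothesis is the named estimate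
`PhaseConcentration η β` (PC) of `…Theorems.SAWDevelopingMapInteriorFlatteningOneMouthEstimates` — an OPEN
statement about the critical `x_c`-weighted SAW arrival law (all but an `η`-fraction of the coherent weight
`Σ_c ‖amp_c M_c‖` has its phase `arg(amp_c M_c)` within `β` of a common direction `χ₀`). PC is NOT asserted
here; it enters only as a hypothesis. The content of the file is the elementary CIRCULAR-RESULTANT lemma

  `coherent_of_phaseConcentration`:  `((1-η) cos β - η) Σ ‖T c‖ ≤ ‖Σ T c‖`

for a finite family of complex numbers all but an `η`-fraction (in modulus) of which have argument within
`β ≤ π/2` of `χ₀`, and its specialisation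

  `farFieldCoherence_of_phaseConcentration`:  `β ≤ π/2 → (1-η) cos β - η > 0 → PC η β → S3'`

with the explicit constant `A = 1 / ((1-η) cos β - η)` (the registered sub-goal this file carries; the
conclusion is the registered S3' signature verbatim). Nothing unproved is asserted.
-/

noncomputable section

open scoped BigOperators
open Literature.Probability.LatticeModels Literature.Probability.RandomPlanarGeometry.SAW

namespace Summit.CriticalPhenomena.SAWScalingLimit.Theorems.InteriorFlattening.OneMouth

/-! ### The circular-resultant lemma -/

/-- **Circular resultant.** If all but an `η`-fraction (in modulus) of a finite family of complex numbers
have argument within `β ≤ π/2` of a common direction `χ₀`, the family is coherent: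
`((1-η) cos β - η) Σ ‖T c‖ ≤ ‖Σ T c‖`. With `(1-η)cos β - η > 0` this is the far-field coherence
inequality with `A = 1/((1-η)cos β - η)`; the hypothesis is the phase-concentration estimate (PC). -/
theorem coherent_of_phaseConcentration {ι : Type*} [DecidableEq ι] (s : Finset ι) (T : ι → ℂ)
    (χ₀ η β : ℝ) (hβ : β ≤ Real.pi / 2)
    (good : Finset ι) (hgood : good ⊆ s)
    (harg : ∀ c ∈ good, |Complex.arg (T c * Complex.exp (-(χ₀ : ℂ) * Complex.I))| ≤ β)
    (htail : ∑ c ∈ s \ good, ‖T c‖ ≤ η * ∑ c ∈ s, ‖T c‖) :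
    ((1 - η) * Real.cos β - η) * ∑ c ∈ s, ‖T c‖ ≤ ‖∑ c ∈ s, T c‖ := by
  -- rotate by `-χ₀`
  set u : ℂ := Complex.exp (-(χ₀ : ℂ) * Complex.I) with hu
  have hu1 : ‖u‖ = 1 := by
    rw [hu, show (-(χ₀ : ℂ) * Complex.I) = ((-χ₀ : ℝ) : ℂ) * Complex.I by push_cast; ring]
    exact Complex.norm_exp_ofReal_mul_I _
  have hTu : ∀ c, ‖T c * u‖ = ‖T c‖ := fun c => by rw [norm_mul, hu1, mul_one]
  -- nonnegativity of `cos β` (if `good` is nonempty it follows from `harg`; in general we split)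
  have hcosβ : 0 ≤ Real.cos β ∨ good = ∅ := by
    by_cases hg : good = ∅
    · exact Or.inr hg
    · obtain ⟨c, hc⟩ := Finset.nonempty_iff_ne_empty.2 hg
      have h0 : 0 ≤ β := (abs_nonneg _).trans (harg c hc)
      exact Or.inl (Real.cos_nonneg_of_mem_Icc ⟨by linarith [Real.pi_pos], hβ⟩)
  -- real part of each good term
  have hre : ∀ c ∈ good, Real.cos β * ‖T c‖ ≤ (T c * u).re := by
    intro c hc
    have key : (T c * u).re = ‖T c‖ * Real.cos (Complex.arg (T c * u)) := by
      rw [← hTu c]; exact (Complex.norm_mul_cos_arg _).symm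
    rw [key, mul_comm]
    refine mul_le_mul_of_nonneg_left ?_ (norm_nonneg _)
    rw [← Real.cos_abs (Complex.arg _)]
    exact Real.cos_le_cos_of_nonneg_of_le_pi (abs_nonneg _) (by linarith [Real.pi_pos]) (harg c hc)
  -- real part of each bad term
  have hbad : ∀ c, -‖T c‖ ≤ (T c * u).re := fun c => by
    have h1 : |(T c * u).re| ≤ ‖T c * u‖ := Complex.abs_re_le_norm (T c * u)
    rw [hTu] at h1
    exact (abs_le.1 h1).1
  -- assemble
  have hsplit : ∑ c ∈ s, ‖T c‖ = ∑ c ∈ s \ good, ‖T c‖ + ∑ c ∈ good, ‖T c‖ :=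
    (Finset.sum_sdiff hgood).symm
  have hsplit' : ∑ c ∈ s, (T c * u).re = ∑ c ∈ s \ good, (T c * u).re + ∑ c ∈ good, (T c * u).re :=
    (Finset.sum_sdiff hgood).symm
  have hG : Real.cos β * ∑ c ∈ good, ‖T c‖ ≤ ∑ c ∈ good, (T c * u).re := by
    rw [Finset.mul_sum]; exact Finset.sum_le_sum hre
  have hB : -∑ c ∈ s \ good, ‖T c‖ ≤ ∑ c ∈ s \ good, (T c * u).re := by
    rw [← Finset.sum_neg_distrib]; exact Finset.sum_le_sum fun c _ => hbad c
  have hnn : 0 ≤ ∑ c ∈ s, ‖T c‖ := Finset.sum_nonneg fun c _ => norm_nonneg _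
  have hnnB : 0 ≤ ∑ c ∈ s \ good, ‖T c‖ := Finset.sum_nonneg fun c _ => norm_nonneg _
  calc ((1 - η) * Real.cos β - η) * ∑ c ∈ s, ‖T c‖
      ≤ Real.cos β * ∑ c ∈ good, ‖T c‖ - ∑ c ∈ s \ good, ‖T c‖ := by
        rcases hcosβ with hcos | hge
        · -- with B := Σ_bad, G := Σ_good, S = B + G, B ≤ η S:
          -- ((1-η)cosβ - η) S = cosβ S - (cosβ+1) η S ≤ cosβ S - (cosβ + 1) B = cosβ G - B
          have h1 : (Real.cos β + 1) * ∑ c ∈ s \ good, ‖T c‖ ≤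
              (Real.cos β + 1) * (η * ∑ c ∈ s, ‖T c‖) :=
            mul_le_mul_of_nonneg_left htail (by linarith)
          have e1 : ((1 - η) * Real.cos β - η) * ∑ c ∈ s, ‖T c‖ =
              Real.cos β * ∑ c ∈ s, ‖T c‖ - (Real.cos β + 1) * (η * ∑ c ∈ s, ‖T c‖) := by ring
          have e2 : Real.cos β * ∑ c ∈ good, ‖T c‖ - ∑ c ∈ s \ good, ‖T c‖ =
              Real.cos β * ∑ c ∈ s, ‖T c‖ - (Real.cos β + 1) * ∑ c ∈ s \ good, ‖T c‖ := by
            rw [hsplit]; ring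
          rw [e1, e2]
          linarith
        · subst hge
          simp only [Finset.sdiff_empty, Finset.sum_empty, mul_zero, zero_sub] at htail ⊢
          -- here `η ≥ 1` unless the total vanishes
          by_cases hz : ∑ c ∈ s, ‖T c‖ = 0
          · rw [hz]; simp
          · have hη : 1 ≤ η := by
              have hpos : 0 < ∑ c ∈ s, ‖T c‖ := lt_of_le_of_ne hnn (Ne.symm hz)
              nlinarith
            have hc1 : Real.cos β ≤ 1 := Real.cos_le_one β
            nlinarith [Real.neg_one_le_cos β]
    _ ≤ ∑ c ∈ good, (T c * u).re + ∑ c ∈ s \ good, (T c * u).re := by linarith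
    _ = (∑ c ∈ s, T c * u).re := by rw [Complex.re_sum, hsplit', add_comm]
    _ ≤ ‖∑ c ∈ s, T c * u‖ := Complex.re_le_norm _
    _ = ‖∑ c ∈ s, T c‖ := by rw [← Finset.sum_mul, norm_mul, hu1, mul_one]

/-- **Circular resultant, tail in filter form.** Same as `coherent_of_phaseConcentration`, with the
`η`-tail measured — as in the estimate (PC) — on the sub-family whose rotated argument EXCEEDS `β`
(`s.filter (β < |arg (T c · e^{-iχ₀})|)`); the good set is its complement in `s`, on which `|arg| ≤ β`. -/
theorem coherent_of_phaseTail {ι : Type*} (s : Finset ι) (T : ι → ℂ) (χ₀ η β : ℝ)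
    (hβ : β ≤ Real.pi / 2)
    [DecidablePred fun c => β < |Complex.arg (T c * Complex.exp (-(χ₀ : ℂ) * Complex.I))|]
    (htail : (∑ c ∈ s.filter
        (fun c => β < |Complex.arg (T c * Complex.exp (-(χ₀ : ℂ) * Complex.I))|), ‖T c‖) ≤
      η * ∑ c ∈ s, ‖T c‖) :
    ((1 - η) * Real.cos β - η) * ∑ c ∈ s, ‖T c‖ ≤ ‖∑ c ∈ s, T c‖ := by
  classical
  -- the good set: rotated argument at most `β`
  set good : Finset ι :=
    s.filter (fun c => ¬ β < |Complex.arg (T c * Complex.exp (-(χ₀ : ℂ) * Complex.I))|) with hgood_def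
  have hgood : good ⊆ s := Finset.filter_subset _ _
  have harg : ∀ c ∈ good, |Complex.arg (T c * Complex.exp (-(χ₀ : ℂ) * Complex.I))| ≤ β :=
    fun c hc => not_lt.1 (Finset.mem_filter.1 hc).2
  have hsd : s \ good =
      s.filter (fun c => β < |Complex.arg (T c * Complex.exp (-(χ₀ : ℂ) * Complex.I))|) := by
    ext c
    simp only [hgood_def, Finset.mem_sdiff, Finset.mem_filter, not_and, not_not]
    constructor
    · rintro ⟨hc, h⟩
      exact ⟨hc, h hc⟩
    · rintro ⟨hc, h⟩
      exact ⟨hc, fun _ => h⟩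
  refine coherent_of_phaseConcentration s T χ₀ η β hβ good hgood harg ?_
  rw [hsd]
  convert htail using 2

/-! ### S3' from PC -/

/-- **S3' ⇐ PC (conditional reduction).** If the phase-concentration estimate `PhaseConcentration η β`
holds with `β ≤ π/2` and `(1-η) cos β - η > 0`, then the WINDOWED far-field coherence S3' holds with the
explicit constant `A = 1 / ((1-η) cos β - η)`: for every simply connected `Λ`, root `a ∈ ∂Λ`, `v ∈ Λ`,
`r ≥ 1` with `B(v,2r) ⊆ Λ` but not `B(v,4r) ⊆ Λ`, and every labelling of the neighbours of `v`,
`Σ_c ‖amp_c‖ ‖M_c‖ ≤ A ‖Σ_c amp_c M_c‖` over the last-entrance configurations `c` of `S = B(v,r)`.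
The conclusion is the registered signature of `stub_farFieldCoherence` verbatim; PC is a hypothesis,
not asserted. Proof: PC supplies the reference direction `χ₀` and the `η`-tail bound for the family
`T_c = amp_c · M_c`; `coherent_of_phaseTail` gives `((1-η)cos β - η) Σ‖T_c‖ ≤ ‖Σ T_c‖`; divide, and
`‖amp_c · M_c‖ = ‖amp_c‖ ‖M_c‖`. -/
theorem farFieldCoherence_of_phaseConcentration :
    ∀ η β : ℝ, β ≤ Real.pi / 2 → 0 < (1 - η) * Real.cos β - η → PhaseConcentration η β →
      ∃ A : ℝ, 0 < A ∧ ∀ Λ : Finset HexVertex, hexDomainSimplyConnected Λ →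
        ∀ a ∈ hexDomainBoundary Λ, ∀ v ∈ Λ, ∀ r : ℝ, 1 ≤ r → Deep Λ v (2 * r) → ¬ Deep Λ v (4 * r) →
        ∀ w₀ w₁ w₂ : HexVertex, IsStar v w₀ w₁ w₂ →
          (∑ c ∈ Conf Λ (ball Λ v r), ‖amp Λ a (ball Λ v r) c‖ * ‖mono c.1 (root c) v w₀ w₁ w₂‖) ≤
            A * ‖∑ c ∈ Conf Λ (ball Λ v r),
              amp Λ a (ball Λ v r) c * mono c.1 (root c) v w₀ w₁ w₂‖ := by
  intro η β hβ hpos hPC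
  refine ⟨1 / ((1 - η) * Real.cos β - η), one_div_pos.2 hpos, ?_⟩
  intro Λ hΛ a ha v hv r hr hdeep hndeep w₀ w₁ w₂ hstar
  obtain ⟨χ₀, hχ₀⟩ := hPC Λ hΛ a ha v hv r hr hdeep hndeep w₀ w₁ w₂ hstar
  -- the family `T_c = amp_c · M_c` over the configurations of `S = B(v, r)`
  set s : Finset Config := Conf Λ (ball Λ v r) with hs
  set T : Config → ℂ := fun c => amp Λ a (ball Λ v r) c * mono c.1 (root c) v w₀ w₁ w₂ with hT
  have key : ((1 - η) * Real.cos β - η) * ∑ c ∈ s, ‖T c‖ ≤ ‖∑ c ∈ s, T c‖ :=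
    coherent_of_phaseTail s T χ₀ η β hβ hχ₀
  have hdiv : ∑ c ∈ s, ‖T c‖ ≤ 1 / ((1 - η) * Real.cos β - η) * ‖∑ c ∈ s, T c‖ := by
    rw [one_div, inv_mul_eq_div, le_div_iff₀ hpos, mul_comm]
    exact key
  calc (∑ c ∈ s, ‖amp Λ a (ball Λ v r) c‖ * ‖mono c.1 (root c) v w₀ w₁ w₂‖)
      = ∑ c ∈ s, ‖T c‖ := Finset.sum_congr rfl fun c _ => (norm_mul _ _).symm
    _ ≤ 1 / ((1 - η) * Real.cos β - η) * ‖∑ c ∈ s, T c‖ := hdiv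

end Summit.CriticalPhenomena.SAWScalingLimit.Theorems.InteriorFlattening.OneMouth

end
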